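import Mathlib
import Literature.MathematicalPhysics.QuantumFieldTheory.Balaban1983to89.B6Prop23TwoLevelInputs

/-!
# `Balaban1983to89.B6Prop23CubeDepth` — the depth binders of the Proposition 2.3 certificate (`hpfdeep`, `hhdeep`,
`hM₀` of `…B6Prop23DomainInput` ∕ `…B6Prop23TwoLevelInputs`) DISCHARGED from cube data of the printed shape: the cover
cube □ inside the enlarged cube □̃ *"containing □ in the middle and of the size 4M"* with a COLLAR of d-depth M_c, the
commutator zone within d-distance w of □̃ᶜ, and the linear depth hypothesis κM ≤ M_c − w (B6 = T. Bałaban,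
*Propagators and renormalization transformations for lattice gauge theories. II*, Commun. Math. Phys. **96**, 223–250
(1984) [Balaban1984PropagatorsII]).

CITATION HEADER (lean-in-tree rule 2026-08-18).  Cell `pub-balaban`, unit `b2b-balaban-b06-g15` (paper sub-cell B06,
gen 15 — the owner lineage of `…B6Prop23Assembled`, `…B6Prop23DomainInput`, `…B6Prop23TwoLevel`,
`…B6Prop23TwoLevelInputs`, which this NEW LEAF imports (the last one, transitively the others) and does not modify).
Source: doi:10.1007/bf01240221, held `paper:balaban1984-cmp96-propagators-rt-ii`; journal page = PDF page + 222; the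
quotations below (pp. 229, 235, 237, 238) were read from the page renders `b2b-balaban-ref1/pages/1984-cmp96-propagators-
rt-II/1984-cmp96-propagators-rt-II-p007, p013, p015, p016-x2.png` AS IMAGES (p013 re-read this gen; p007∕p015∕p016 as
certified under GAPS C-b06g9-1, C-b06g12-2∕-3∕-7).  Cell rows: GAPS C-b06g15-2 (this module), C-b06g15-1 (the B06
census `HOME/b2b-balaban-b06-g15/CENSUS-B6-v1.md`, objection O-14 and hypothesis H-B6.5, which this module addresses),
DIVERGENCE D-b06.34; journal claim PROP23-CUBE-DEPTH.

THE PRINTED TEXT.  p. 229 [PDF 7]: *"We cover B^j(Λ_j) by a sum of cubes □ of the size 2ML^jη, each cube being a sum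
of 2^d big blocks with a center y ∈ Λ_j"*, with the partition of unity {h_□}, *"Σ_{□∈𝒟} h_□² = 1. (2.36)"*.  p. 235
[PDF 13]: *"The approximate inverse can be constructed by taking inverses of the localized operators (Q′G′²Q′*)↾□ and
glueing them together by the decomposition of unity {h_□}. We change this prescription a little bit; we take a second
cube □̃ containing □ in the middle and of the size 4M and we take an inverse of the operator (Q′G′(□̃)²Q′*)↾□ instead
of (Q′G′²Q′*)↾□."*  p. 238 [PDF 16] (the use): *"for example the operator with G′(□̃)² − G′² is small and an estimate
has the factor e^{−δ₀M} because of the usual estimate of the type (1.12) [3] connected with a change of a domain. …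
An estimate of the terms with the commutator is even simpler and gives a factor O(M^{−1})."*

THE POINT.  In the located line-3 chain of the tree (`B6DomainMajorantSandwichProfile` ⟹ `B6Prop23DomainInput.
hdom_of_line3` ∕ `hdom_family` ⟹ `prop23_assembled_fine` ⟹ gen 14's two-level `B6Prop23TwoLevelInputs.
prop23_assembled_fine_twoLevel`) the geometry of □ ⊂ □̃ enters through THREE ABSTRACT BINDERS: `hpfdeep : ∀ y, □(y) ≠ 0 →
∀ n ∈ N_□, M₀ ≤ d(y, n)` and `hhdeep` (the same for supp h_□) — the cube and the support of h_□ lie at d-depth ≥ M₀ below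
the commutator zone N_□ of the cut-off χ_□̃ — and the depth comparison `hM₀ : c₃M ≤ ((δ − α′δ₀)∕3)M₀` ("M₀ ≍ M", left
as a hypothesis by gens 9–14; census O-14).  THIS MODULE derives the three binders from data of the PRINTED shape by the
triangle inequality of the multiscale distance (2.54): (i) supp □, supp h_□ ⊂ □ (p. 229, (2.36): h_□ is carried by its
cube — typed upstream as `hph : □·h_□ = h_□`); (ii) the COLLAR of □̃: every coarse site outside □̃ is at d-distance ≥ M_c
from □ (p. 235 *"containing □ in the middle and of the size 4M"*, □ of size 2M: the collar has width M in L^jη-units, so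
M_c = M when □̃ ⊂ B^j(Λ_j), and M_c ≥ M∕L when □̃ also meets B^{j+1}(Λ_{j+1}), where (2.46) measures the collar in
L^{j+1}η-units); (iii) the ZONE: every site of N_□ is within d-distance w of a site outside □̃ (the commutator χ_□̃D − Dχ_□̃
of a finite-range D lives on the blocks meeting ∂□̃; w = its range in the d-metric); (iv) the LINEAR DEPTH hypothesis
κM ≤ M_c − w with κ > 0 (κ = ½ for M ≥ 2w on one level; κ ≍ 1∕(2L) at a level interface).  Then M₀ := M_c − w and
c₃ := ((δ − α′δ₀)∕3)·κ satisfy the three binders, and the Proposition 2.3 certificate is re-assembled with them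
(§2): every OTHER binder and the conclusion are VERBATIM those of `prop23_assembled_fine_twoLevel`.

WHAT THIS MODULE PROVES (kernel-checked; no `sorry`, no axiom beyond Lean's three; no new definition):
1. §1 (any pseudo-distance; only the triangle inequality is used) `dist_ge_of_collar` — collar M_c below the outside +
   zone within w of the outside ⟹ d(y, n) ≥ M_c − w; `deep_of_cubes` — the family form producing EXACTLY the binder
   shape `∀ i y, f i y ≠ 0 → ∀ n ∈ N i, M_c − w ≤ d(y, n)` of `hpfdeep`∕`hhdeep` (f = □_i or h_i); `c3_of_depth` — the
   binder `hM₀` with c₃ := r·κ, M₀ := M_c − w from κM ≤ M_c − w (r = (δ − α′δ₀)∕3 ≥ 0).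
2. §2 `prop23_assembled_fine_twoLevel_cubes` — `B6Prop23TwoLevelInputs.prop23_assembled_fine_twoLevel` with the binders
   `hc₃`, `hpfdeep`, `hhdeep`, `hM₀` (and the implicit `c₃`, `M₀`) REPLACED by the cube data `sq`, `bsq` (□_i, □̃_i as
   predicates on coarse sites), `hpfsq`∕`hhsq` (supports in □_i), `hcollar`, `hzone`, `hκ`, `hdepth`; the threshold `hKM`
   is the upstream one with c₃ := ((δ − α′δ₀)∕3)·κ; conclusion verbatim (two-sided inverse of Q′G′²Q′* in the pairing
   (2.69), (2.86), uniqueness, (2.87) with the same O(1)).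
3. §3 `cubeData_nonvacuous` — the NEW geometric binders (pseudo-distance, □ ≠ ∅, zone ≠ ∅ and meeting □̃, collar,
   zone width, κ > 0, M > 0, κM ≤ M_c − w) hold together on a 9-point line (d = |i − i′|, □ = {4}, □̃ = {2,…,6},
   N = {2, 6}, M_c = 3, w = 1, M = 4, κ = ½).

TYPING ∕ DIVERGENCE (cell DIVERGENCE.md D-b06.34).  (a) □_i, □̃_i are PREDICATES on the coarse sites 𝔅 = `g.Site`
(the typed chain never needs them as fine-lattice sets: χ_i, `blk` and `hχN` carry the fine side upstream); (b) the
collar is stated in the d-METRIC (2.46) (`g.dist`), not in lattice units — the conversion "width M in L^jη-units ⟹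
d-depth M (one level) or ≥ M∕L (interface)" is the content of the hypothesis `hcollar` + `hdepth`, NOT derived here from
a coordinatised cube (the tree's `B6Geometry` types d as a graph distance of admissible bonds without coordinates; a
coordinatised cover is not in the tree — census H-B6.5); (c) the zone hypothesis `hzone` is stated for the abstract
zone N_i of the upstream commutator majorants `hKGw`∕`hKG`; that the commutator of the □̃-cut-off with the printed
Δ′-type operator is carried by blocks within w = O(1) of ∂□̃ is the finite range of that operator, an input of the same
standing as `hχN` upstream; (d) κ is a free positive parameter: the module does not decide between κ = ½ and κ ≍ 1∕(2L)
(both are instances), and c₃ = ((δ − α′δ₀)∕3)κ then enters the threshold constant K₂₈₅ᵀᴸ exactly where the abstract c₃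
did.

HONEST SCOPE ∕ NOT CLAIMED.  Bookkeeping only: three abstract binders of one located certificate are replaced by five
binders of the printed geometric shape plus one linear comparison; no analytic input of B6 Sect. B is touched (all the
other located hypotheses of `prop23_assembled_fine_twoLevel` are carried verbatim); no coordinatised construction of the
cover 𝒟 or of □̃ is given (so "M₀ ≍ M for Bałaban's actual cubes" is reduced to `hcollar` + `hdepth`, not proved from
(2.1)–(2.4)); nothing about d = 4, the continuum, or the summit `YangMillsMassGap`.  VALUE = kernel bookkeeping of ONE
technical paper at fixed lattice spacing; NOT summit progress.
-/

namespace Literature.MathematicalPhysics.QuantumFieldTheory.Balaban1983to89.B6Prop23CubeDepth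

open Finset Real
open B4Sect5Torus (IsPseudoDist)
open B6DomainChange (Profile)
open B6RandomWalk (HasMajorant Ineq260)
open B6RandomWalkHom (HasMajorantHom)
open B6DomainMajorant (Ctot)
open B6Expansion282 (kerOp locOp Cglued R282)
open B6Prop23Chain (mat)
open B6Lemma21Repaired (Ineq261With Ineq263With)
open B6Ineq268 (LevelSep)
open B6Prop23TwoLevel (K285TL)
open B6Prop23TwoLevelInputs (prop23_assembled_fine_twoLevel)

/-! ## §1  Collar below the outside + zone near the outside ⟹ depth below the zone (triangle inequality only) -/

section Metric

variable {S : Type}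

/-- **Depth from a collar.**  If every site outside the enlarged cube □̃ (`bsq`) is at distance ≥ M_c from the site y
(y in the cube □, p. 235 *"□̃ containing □ in the middle and of the size 4M"*), and the zone site n is within distance
w of some site outside □̃, then d(y, n) ≥ M_c − w — the triangle inequality (2.54) d(y, z) ≤ d(y, n) + d(n, z).  Only
`triangle` of the pseudo-distance is used. [cite: Balaban1984PropagatorsII, p.235 before (2.70); (2.54) p.233] -/
theorem dist_ge_of_collar {ρ : S → S → ℝ} (htri : ∀ x y z, ρ x z ≤ ρ x y + ρ y z) {bsq : S → Prop} {Mc w : ℝ}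
    {y n : S} (hy : ∀ z, ¬ bsq z → Mc ≤ ρ y z) (hn : ∃ z, ¬ bsq z ∧ ρ n z ≤ w) : Mc - w ≤ ρ y n := by
  obtain ⟨z, hz, hnz⟩ := hn
  have h1 := hy z hz
  have h2 := htri y n z
  linarith

/-- **The binder shape of `hpfdeep` ∕ `hhdeep`.**  For a family of cubes □_i ⊂ □̃_i with zones N_i: a function f_i
carried by □_i (f = the indicator □_i itself, or h_□ᵢ — p. 229 (2.36)), the collar of □̃_i of d-depth M_c below its
outside, and the zone N_i within d-distance w of that outside give `∀ i y, f i y ≠ 0 → ∀ n ∈ N i, M_c − w ≤ d(y, n)` —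
literally the hypothesis `hpfdeep`∕`hhdeep` of `B6Prop23DomainInput.hdom_family` and of
`B6Prop23TwoLevelInputs.prop23_assembled_fine_twoLevel` with M₀ := M_c − w.
[cite: Balaban1984PropagatorsII, p.235 before (2.70); p.229 (2.36); p.238 before (2.85)] -/
theorem deep_of_cubes {ι : Type} {ρ : S → S → ℝ} (htri : ∀ x y z, ρ x z ≤ ρ x y + ρ y z)
    {sq bsq : ι → S → Prop} {N : ι → Finset S} {f : ι → S → ℝ} {Mc w : ℝ}
    (hf : ∀ i y, f i y ≠ 0 → sq i y) (hcollar : ∀ i y z, sq i y → ¬ bsq i z → Mc ≤ ρ y z)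
    (hzone : ∀ i n, n ∈ N i → ∃ z, ¬ bsq i z ∧ ρ n z ≤ w) :
    ∀ i y, f i y ≠ 0 → ∀ n ∈ N i, Mc - w ≤ ρ y n := by
  intro i y hfy n hn
  exact dist_ge_of_collar htri (fun z hz => hcollar i y z (hf i y hfy) hz) (hzone i n hn)

/-- **The binder `hM₀`.**  With the linear depth hypothesis κM ≤ M_c − w, the choice c₃ := r·κ, M₀ := M_c − w
satisfies c₃M ≤ r·M₀ for any rate r ≥ 0 (r = (δ − α′δ₀)∕3 in the certificate). [folklore] -/
theorem c3_of_depth {r κ M Mc w : ℝ} (hr : 0 ≤ r) (hdepth : κ * M ≤ Mc - w) :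
    r * κ * M ≤ r * (Mc - w) := by
  rw [mul_assoc]
  exact mul_le_mul_of_nonneg_left hdepth hr

/-- The one-level instance of the linear depth hypothesis: if the zone width is at most half the collar depth and the
collar depth is M itself (□̃ ⊂ B^j(Λ_j): the collar of p. 235 has width M in L^jη-units), then κ = ½ works:
½M ≤ M − w. [folklore] -/
theorem depth_half {M w : ℝ} (hw : 2 * w ≤ M) : (1 / 2 : ℝ) * M ≤ M - w := by
  linarith

/-- The interface instance: if the collar depth is only M∕L (□̃ meeting B^{j+1}(Λ_{j+1}), (2.46) measuring the collar in
L^{j+1}η-units) and 2wL ≤ M, then κ = 1∕(2L) works: M∕(2L) ≤ M∕L − w. [folklore] -/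
theorem depth_interface {M w L : ℝ} (hL : 0 < L) (hw : 2 * w * L ≤ M) : 1 / (2 * L) * M ≤ M / L - w := by
  have h2L : (0 : ℝ) < 2 * L := by positivity
  have key : 1 / (2 * L) * M = M / L - M / (2 * L) := by
    field_simp
    ring
  have hw' : w * (2 * L) ≤ M :=
    calc w * (2 * L) = 2 * w * L := by ring
      _ ≤ M := hw
  have hwle : w ≤ M / (2 * L) := by rwa [le_div_iff₀ h2L]
  linarith [key, hwle]

end Metric

/-! ## §2  Proposition 2.3 (two-level, change-of-domain input discharged) with the depth binders from cube data -/

section Reassembly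

variable {g : B6.Geometry} [DecidableEq g.Site] {X : Type} {ι : Type} [Fintype ι] [DecidableEq ι]

/-- **PROPOSITION 2.3 WITH THE DEPTH BINDERS DISCHARGED FROM CUBE DATA** —
`B6Prop23TwoLevelInputs.prop23_assembled_fine_twoLevel` (p. 238 before (2.85) ⟹ (2.85) ⟹ Lemma 2.1 ⟹ (2.86)–(2.87),
two-level supports, change-of-domain input discharged by `B6Prop23DomainInput.hdom_family`) in which the abstract depth
binders `hpfdeep`, `hhdeep` (supp □_i, supp h_i at d-depth ≥ M₀ below the zone N_i) and `hM₀ : c₃M ≤ ((δ−α′δ₀)∕3)M₀`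
(with `hc₃ : 0 < c₃`) are REPLACED by: the cubes □_i = `sq i` and enlarged cubes □̃_i = `bsq i` as predicates on 𝔅,
`hpfsq`∕`hhsq` (□_i and h_i carried by □_i — p. 229, (2.36)), `hcollar` (p. 235 *"a second cube □̃ containing □ in the
middle and of the size 4M"*: the outside of □̃_i at d-distance ≥ M_c from □_i), `hzone` (N_i within d-distance w of
that outside), `hκ`, `hdepth` (κM ≤ M_c − w).  Internally M₀ := M_c − w, c₃ := ((δ − α′δ₀)∕3)·κ (so the threshold
`hKM` carries that c₃); every other hypothesis and the conclusion VERBATIM those of `prop23_assembled_fine_twoLevel`.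
[cite: Balaban1984PropagatorsII, Proposition 2.3 (2.85)–(2.87) p.238; p.235 before (2.70); p.229 (2.36)] -/
theorem prop23_assembled_fine_twoLevel_cubes (d : ℕ) (hρ : IsPseudoDist g.dist) (hsep : LevelSep g) (hL : 1 ≤ g.L)
    (hη : 0 < g.eta) (hM : 0 < g.M) (hRM : 0 ≤ g.R * g.M)
    -- the fine-lattice side: blocks, (2.60), the (2.61) profile, the located size condition
    (blk : X → g.Site) {δ₀ α' : ℝ} (h260 : Ineq260 g δ₀ α') {K : ℝ → ℝ}
    (hK : ∀ a, 0 < a → 0 ≤ K a) (hPr : Profile g.dist (fun a : g.Site => a) K) (hα' : 0 ≤ α' * δ₀)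
    (hsize : g.L ^ 2 * Real.exp (-(α' * δ₀ * (g.R * g.M))) ≤ 1)
    {δ B₁ θ : ℝ} (hκδ : α' * δ₀ < δ) (hB₁ : 0 ≤ B₁) (hθ : 0 ≤ θ)
    -- the constants of the assembled Prop. 2.3 (its δ₀ is (δ − α′δ₀)/3 here); c₃ is now ((δ − α′δ₀)/3)·κ
    {δ₁ σ cσ c s mg BX BC : ℝ} (hδ₁ : 0 ≤ δ₁) (hsplit : δ₁ + σ * ((δ - α' * δ₀) / 3) ≤ (δ - α' * δ₀) / 3 / 4)
    (h261σ : Ineq261With cσ g ((δ - α' * δ₀) / 3) σ)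
    (hthr : g.L ^ 4 ≤ Real.exp (1 / 8 * ((δ - α' * δ₀) / 3) * g.R * g.M))
    (h261 : Ineq261With c g δ₁ (1 / 2)) (h263 : Ineq263With c g δ₁ (1 / 2)) (hc : 0 ≤ c)
    (hs : 0 ≤ s) (hmg : 0 < mg) (hBX : 0 ≤ BX) (hBC : 0 ≤ BC)
    -- the cubes □_i = pf i, the partition of unity h_i = hf i, the kernels X, X̃_i, C_i in the pairing (2.69)
    {pf hf : ι → g.Site → ℝ} {js : ι → ℕ} {n₀ : ℕ} {Xk : g.Site → g.Site → ℝ}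
    {Xwk Ck : ι → g.Site → g.Site → ℝ}
    (hover : ∀ y, (Finset.univ.filter fun i => hf i y ≠ 0).card ≤ n₀)
    (hpf01 : ∀ i y, pf i y = 0 ∨ pf i y = 1) (hph : ∀ i y, pf i y * hf i y = hf i y)
    (h236 : ∀ y, ∑ i, hf i y ^ 2 = 1) (hLip : ∀ i y y'', |hf i y - hf i y''| ≤ s / g.M * g.dist y y'')
    (hcube : ∀ i y, pf i y ≠ 0 → js i ≤ g.scale y ∧ g.scale y ≤ js i + 1)
    (hgap : ∀ i y y'', pf i y = 0 → hf i y'' ≠ 0 → mg * g.M ≤ g.dist y y'')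
    (hX : ∀ y y'', |g.len y'' ^ d * Xk y y''| ≤
      BX * g.len y ^ 4 * Real.exp (-(1 / 2 * ((δ - α' * δ₀) / 3) * g.dist y y'')))
    (hXw : ∀ i y y'', |g.len y'' ^ d * Xwk i y y''| ≤
      BX * g.len y ^ 4 * Real.exp (-(1 / 2 * ((δ - α' * δ₀) / 3) * g.dist y y'')))
    (h281 : ∀ i y y', pf i y ≠ 0 → pf i y' ≠ 0 →
      |Ck i y y'| ≤ BC / (g.L ^ js i * g.eta) ^ (d + 4) * Real.exp (-(δ₁ * g.dist y y')))
    (hCk0 : ∀ i y'' y', pf i y'' = 0 → Ck i y'' y' = 0)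
    (h270 : ∀ i, locOp (fun i => B6Expansion282.mulOp (pf i)) (fun i => kerOp (fun z => g.len z ^ d) (Xwk i)) i *
      kerOp (fun z => g.len z ^ d) (Ck i) * B6Expansion282.mulOp (hf i) = B6Expansion282.mulOp (hf i))
    -- the fine-lattice data of each cube: zone N_i, cut-off χ_i, D_i, G′(□̃_i) = Gw i; G′ = G, Q′ = Qp, Q′* = Qs
    (N : ι → Finset g.Site) (hN : ∀ i, (N i).Nonempty)
    {G : Module.End ℝ (X → ℝ)} {Dop Gw : ι → Module.End ℝ (X → ℝ)} {χ : ι → X → ℝ}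
    (hχ1 : ∀ i x, |χ i x| ≤ 1)
    (hpfχ : ∀ i x, pf i (blk x) * χ i x = pf i (blk x)) (hhχ : ∀ i x, χ i x * hf i (blk x) = hf i (blk x))
    (hχN : ∀ i x, blk x ∉ N i → χ i x = 1)
    (hGD : ∀ i, G * Dop i = 1) (hDG : ∀ i, Dop i * G = 1)
    (hχGw : ∀ i, B9Thm37Sum.mulOp (χ i) * Dop i * Gw i = B9Thm37Sum.mulOp (χ i))
    (hGwχ : ∀ i, Gw i * Dop i * B9Thm37Sum.mulOp (χ i) = B9Thm37Sum.mulOp (χ i))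
    (hG : HasMajorant blk G (fun a b => B₁ * g.len a ^ 2 * Real.exp (-(δ * g.dist a b))))
    (hGw : ∀ i, HasMajorant blk (Gw i) (fun a b => B₁ * g.len a ^ 2 * Real.exp (-(δ * g.dist a b))))
    (hKGw : ∀ i, HasMajorant blk ((B9Thm37Sum.mulOp (χ i) * Dop i - Dop i * B9Thm37Sum.mulOp (χ i)) * Gw i)
      (fun a b => (if a ∈ N i then θ else 0) * Real.exp (-(δ * g.dist a b))))
    (hKG : ∀ i, HasMajorant blk ((B9Thm37Sum.mulOp (χ i) * Dop i - Dop i * B9Thm37Sum.mulOp (χ i)) * G)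
      (fun a b => (if a ∈ N i then θ else 0) * Real.exp (-(δ * g.dist a b))))
    -- NEW: the cube data replacing `hpfdeep`, `hhdeep`, `hM₀`, `hc₃`
    {sq bsq : ι → g.Site → Prop} {Mc w κ : ℝ} (hκ : 0 < κ)
    (hpfsq : ∀ i y, pf i y ≠ 0 → sq i y) (hhsq : ∀ i y, hf i y ≠ 0 → sq i y)
    (hcollar : ∀ i y z, sq i y → ¬ bsq i z → Mc ≤ g.dist y z)
    (hzone : ∀ i n, n ∈ N i → ∃ z, ¬ bsq i z ∧ g.dist n z ≤ w)
    (hdepth : κ * g.M ≤ Mc - w)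
    -- the Q′-data
    {Qp : (X → ℝ) →ₗ[ℝ] (g.Site → ℝ)} {Qs : (g.Site → ℝ) →ₗ[ℝ] (X → ℝ)} {cQ cQs : ℝ} (hcQ : 0 ≤ cQ)
    (hcQs : 0 ≤ cQs)
    (hQ : HasMajorantHom blk (fun y : g.Site => y) Qp (fun (a b : g.Site) => cQ * (if a = b then (1 : ℝ) else 0)))
    (hQs : HasMajorantHom (fun y : g.Site => y) blk Qs (fun (a b : g.Site) => cQs * (if a = b then (1 : ℝ) else 0)))
    (hQχ : ∀ i, (B9Thm37Sum.mulOp (pf i) : Module.End ℝ (g.Site → ℝ)) ∘ₗ Qp =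
      Qp ∘ₗ (B9Thm37Sum.mulOp (pf i ∘ blk) : Module.End ℝ (X → ℝ)))
    (hQsh : ∀ i, Qs ∘ₗ (B9Thm37Sum.mulOp (hf i) : Module.End ℝ (g.Site → ℝ)) =
      (B9Thm37Sum.mulOp (hf i ∘ blk) : Module.End ℝ (X → ℝ)) ∘ₗ Qs)
    -- the dictionary (definitions of X, X̃_i as the (2.69)-kernels of Q′G′²Q′*, Q′G′(□̃_i)²Q′*)
    (hXdef : kerOp (fun z => g.len z ^ d) Xk = Qp ∘ₗ (G * G) ∘ₗ Qs)
    (hXwdef : ∀ i, kerOp (fun z => g.len z ^ d) (Xwk i) = Qp ∘ₗ (Gw i * Gw i) ∘ₗ Qs)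
    -- «M large enough», with B_D := c_Q c_{Q*} L² C_tot and c₃ := ((δ − α′δ₀)/3)·κ
    (hKM : 2 * K285TL g d n₀ s ((δ - α' * δ₀) / 3) cσ ((δ - α' * δ₀) / 3 * κ) mg BX
      (cQ * cQs * (g.L ^ 2 * Ctot K B₁ θ (δ - α' * δ₀))) BC * c ≤ g.M) :
    ∃ Ginv : Module.End ℝ (g.Site → ℝ),
      Ginv * kerOp (fun z => g.len z ^ d) Xk = 1 ∧ kerOp (fun z => g.len z ^ d) Xk * Ginv = 1 ∧
      Ginv = Cglued (fun i => B6Expansion282.mulOp (hf i)) (fun i => kerOp (fun z => g.len z ^ d) (Ck i)) +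
        Ginv * R282 (kerOp (fun z => g.len z ^ d) Xk) (fun i => B6Expansion282.mulOp (pf i))
          (fun i => kerOp (fun z => g.len z ^ d) (Xwk i)) (fun i => B6Expansion282.mulOp (hf i))
          (fun i => kerOp (fun z => g.len z ^ d) (Ck i)) ∧
      (∀ G' : Module.End ℝ (g.Site → ℝ), G' * kerOp (fun z => g.len z ^ d) Xk = 1 → G' = Ginv) ∧
      ∀ y y', |mat Ginv y y' / g.len y' ^ d| ≤
        2 * (n₀ * (BC * g.L ^ (d + 4))) * c * g.len y ^ (-(4 : ℝ)) * g.len y' ^ (-(d : ℝ)) *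
          Real.exp (-(δ₁ / 2 * g.dist y y')) := by
  have hδA : 0 < (δ - α' * δ₀) / 3 := by linarith
  have hc₃ : 0 < (δ - α' * δ₀) / 3 * κ := mul_pos hδA hκ
  have hpfdeep : ∀ i y, pf i y ≠ 0 → ∀ n ∈ N i, Mc - w ≤ g.dist y n :=
    deep_of_cubes hρ.triangle hpfsq hcollar hzone
  have hhdeep : ∀ i y, hf i y ≠ 0 → ∀ n ∈ N i, Mc - w ≤ g.dist y n :=
    deep_of_cubes hρ.triangle hhsq hcollar hzone
  have hM₀ : (δ - α' * δ₀) / 3 * κ * g.M ≤ (δ - α' * δ₀) / 3 * (Mc - w) := c3_of_depth hδA.le hdepth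
  exact prop23_assembled_fine_twoLevel d hρ hsep hL hη hM hRM blk h260 hK hPr hα' hsize hκδ hB₁ hθ hδ₁ hsplit h261σ
    hthr h261 h263 hc hc₃ hs hmg hBX hBC hover hpf01 hph h236 hLip hcube hgap hX hXw h281 hCk0 h270 N hN hχ1 hpfχ hhχ
    hχN hGD hDG hχGw hGwχ hG hGw hKGw hKG hpfdeep hhdeep hcQ hcQs hQ hQs hQχ hQsh hXdef hXwdef hM₀ hKM

end Reassembly

/-! ## §3  The new geometric binders hold together (a 9-point line) -/

/-- **Non-vacuity of the cube data.**  On the line {0, …, 8} with d(i, i′) = |i − i′| take □ = {4}, □̃ = {2, …, 6},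
the zone N = {2, 6} (inside □̃, next to its outside), M_c = 3, w = 1, M = 4, κ = ½: d is a pseudo-distance, □ and N
are non-empty, N meets □̃, the collar, zone and linear depth hypotheses of §2 hold with κ > 0, M > 0 — so the binders
`hpfsq`∕`hhsq`∕`hcollar`∕`hzone`∕`hκ`∕`hdepth` replacing `hpfdeep`∕`hhdeep`∕`hM₀`∕`hc₃` are jointly satisfiable and
non-degenerate (positive depth M_c − w = 2). [folklore] -/
theorem cubeData_nonvacuous :
    ∃ (S : Type) (ρ : S → S → ℝ) (sq bsq : S → Prop) (N : Finset S) (Mc w M κ : ℝ),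
      IsPseudoDist ρ ∧ (∃ y, sq y) ∧ N.Nonempty ∧ (∃ n ∈ N, bsq n) ∧ 0 < κ ∧ 0 < M ∧ 0 < Mc - w ∧
      (∀ y z, sq y → ¬ bsq z → Mc ≤ ρ y z) ∧ (∀ n ∈ N, ∃ z, ¬ bsq z ∧ ρ n z ≤ w) ∧ κ * M ≤ Mc - w := by
  refine ⟨Fin 9, fun i j => |((i : ℕ) : ℝ) - ((j : ℕ) : ℝ)|, fun y => (y : ℕ) = 4,
    fun z => 2 ≤ (z : ℕ) ∧ (z : ℕ) ≤ 6, {2, 6}, 3, 1, 4, 1 / 2, ?_, ⟨4, rfl⟩, ⟨2, by simp⟩,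
    ⟨2, by simp, by decide⟩, by norm_num, by norm_num, by norm_num, ?_, ?_, by norm_num⟩
  · exact { symm := fun x y => abs_sub_comm _ _
            zero := fun x => by simp
            triangle := fun x y z => abs_sub_le _ _ _ }
  · intro y z hy hz
    dsimp only at hy hz ⊢
    have hy' : ((y : ℕ) : ℝ) = 4 := by exact_mod_cast hy
    rw [hy']
    have hz9 : (z : ℕ) < 9 := z.isLt
    rcases Nat.lt_or_ge (z : ℕ) 2 with h | h
    · have : ((z : ℕ) : ℝ) ≤ 1 := by exact_mod_cast Nat.lt_succ_iff.mp h
      rw [abs_of_nonneg (by linarith)]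
      linarith
    · have h7 : 7 ≤ (z : ℕ) := by
        by_contra h7
        exact hz ⟨h, by omega⟩
      have : (7 : ℝ) ≤ ((z : ℕ) : ℝ) := by exact_mod_cast h7
      rw [abs_of_nonpos (by linarith)]
      linarith
  · intro n hn
    dsimp only
    simp only [Finset.mem_insert, Finset.mem_singleton] at hn
    rcases hn with rfl | rfl
    · exact ⟨1, by decide, by norm_num⟩
    · exact ⟨7, by decide, by norm_num⟩

end Literature.MathematicalPhysics.QuantumFieldTheory.Balaban1983to89.B6Prop23CubeDepth
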